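import Summits.AtomisticToContinuum.Crystallization.Theses.FreeSplittingCertificates
import Summits.AtomisticToContinuum.Crystallization.Theorems.ThreeConeCertificateDefectVanishCrystallizes
import Literature.MathematicalPhysics.StatisticalMechanics.CrystallizationLocalLimit
import Literature.MathematicalPhysics.StatisticalMechanics.CrystallizationSymmetries
import Literature.MathematicalPhysics.StatisticalMechanics.PeriodicConfigurationSums
import Literature.MathematicalPhysics.StatisticalMechanics.LennardJonesClusters

/-!
# Route FreeSplittingCertificates — the hinge `DefectVanishCrystallizes`
# (item stmt-AtomisticToContinuum-12567)

`DefectVanishCrystallizes`: for every periodic configuration `P` of `ℝ³`, if along every sequence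
of Lennard-Jones ground states and for every window radius `R'` and tolerance `ε'` the density of
particles `i` whose `R'`-window is NOT two-sidedly `ε'`-matched to `x_i + A(P.points − q)` for some
base point `q ∈ P.points` and some linear isometry `A` tends to `0` ("DefectVanish(P)", the
UNROOTED window form of this route), then `IsCrystallizing lennardJones 3`
(Blanc–Lewin 2015, §2.1 (15)–(17)).

Proof (soft; stated for a general potential `V`, dimension `d` and periodic `P` as
`isCrystallizing_of_defectVanish`). Given ground states `x^N`:
1. at every scale `k` (radius `k+1`, tolerance `1/(k+1)`) the density of bad particles tends to
   `0`, so eventually in `N` some particle is good (`exists_good_of_card_div_lt`, imported from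
   `ThreeConeCertificateDefectVanishCrystallizes`); `Filter.extraction_forall_of_eventually` picks
   `N_k ↑`, good particles `i_k`, base points `q_k ∈ P.points` and charts `A_k`;
2. (the only new step w.r.t. the rooted twin, item 0752) PIGEONHOLE ON THE MOTIF: `q_k = z_k + g_k`
   with `z_k` in the finite motif and `g_k` in the lattice (`exists_sub_mem_lattice`), so along a
   further subsequence `z_k ≡ z₀`; since the lattice preserves `P.points`,
   `P.points − q_k = P.points − z₀ = (P.translate (−z₀)).points` there, i.e. the windows are ROOTED
   windows of the single periodic configuration `P₀ := P.translate (−z₀)` (and matching at scale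
   `ψ₁ l ≥ l` implies matching at scale `l`);
3. recentre (`τ = −x_{i}`) and apply `eventually_matched_isometryImage` (compactness of the linear
   isometries, imported): along a subsequence the recentred configurations are, for every `R`,
   `ε > 0`, eventually two-way `ε`-matched on `‖·‖ ≤ R` with `P₀.isometryImage B`;
4. the uniform minimal distance of ground states (`LennardJonesMinimalDistance_holds`, proved)
   makes `PeriodicConfiguration.tendsto_sum_of_eventually_near'` applicable: local convergence with
   multiplicity `m ≡ 1`.
All `[folklore]` (Blanc–Lewin 2015, §2.1–2.2).
-/

noncomputable section

namespace Summit.AtomisticToContinuum.Crystallization.Theorems.FreeSplittingCertificatesDefectVanishCrystallizes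

open Literature.MathematicalPhysics.StatisticalMechanics
open Summit.AtomisticToContinuum.Crystallization.Theorems.ThreeConeCertificateDefectVanishCrystallizes
open Filter Topology Metric

variable {d : ℕ}

/-- **Unrooted windows of `P` at a lattice-equivalent base point are rooted windows of a
translate.** If `q ∈ P.points` and `q - z₀ ∈ P.lattice`, then `p ↦ p - q` maps `P.points` onto
`(P.translate (-z₀)).points`. [folklore] -/
theorem mem_points_translate_neg_iff (P : PeriodicConfiguration d) {q z₀ : EuclideanSpace ℝ (Fin d)}
    (hqz : q - z₀ ∈ P.lattice) (w : EuclideanSpace ℝ (Fin d)) :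
    w ∈ (P.translate (-z₀)).points ↔ w + q ∈ P.points := by
  rw [P.mem_points_translate, sub_neg_eq_add]
  constructor
  · intro h
    have := P.add_mem_points h hqz
    rwa [add_add_sub_cancel] at this
  · intro h
    have := P.add_mem_points h (P.lattice.neg_mem hqz)
    rwa [neg_sub, add_add_sub_cancel] at this

/-- **Soft assembly, unrooted form (general potential, dimension and reference configuration).**
If, for one periodic configuration `P` of `ℝᵈ`, every window radius `R > 0` and tolerance
`ε > 0`, along every sequence of ground states of `V` the density of particles `i` admitting NO
base point `q ∈ P.points` and linear isometry `A` with the particles in `B̄_R(x_i)` two-way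
`ε`-matched to `x_i + A((P.points − q) ∩ B̄_R)` tends to `0`, and the ground states of `V` have a
uniform minimal distance `δ > 0`, then `V` crystallizes in dimension `d` in the sense of
Blanc–Lewin (`IsCrystallizing V d`): the limit is a rotated translate
`(P.translate (-z₀)).isometryImage B` of `P`, with multiplicity `m ≡ 1`. [folklore] -/
theorem isCrystallizing_of_defectVanish {V : ℝ → ℝ} (P : PeriodicConfiguration d)
    (hDV : ∀ R ε : ℝ, 0 < R → 0 < ε → ∀ x : (N : ℕ) → (Fin N → EuclideanSpace ℝ (Fin d)),
      (∀ N, IsGroundState V (x N)) →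
      Tendsto (fun N : ℕ => (Nat.card {i : Fin N // ¬ (∃ q ∈ P.points,
        ∃ A : EuclideanSpace ℝ (Fin d) →ₗᵢ[ℝ] EuclideanSpace ℝ (Fin d),
        (∀ p ∈ P.points, dist p q ≤ R → ∃ j, dist (x N j) (x N i + A (p - q)) ≤ ε) ∧
        (∀ j, dist (x N j) (x N i) ≤ R → ∃ p ∈ P.points, dist (x N j) (x N i + A (p - q)) ≤ ε))}
          : ℝ) / N) atTop (𝓝 0))
    {δ : ℝ} (hδ : 0 < δ)
    (hsep : ∀ (N : ℕ) (x : Fin N → EuclideanSpace ℝ (Fin d)), IsGroundState V x →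
      ∀ i j, i ≠ j → δ ≤ dist (x i) (x j)) :
    IsCrystallizing V d := by
  intro x hx
  -- Step 1: at every scale `k`, eventually in `N`, a good particle with its base point and chart
  have hev : ∀ k : ℕ, ∀ᶠ N in atTop, ∃ (i : Fin N) (q : EuclideanSpace ℝ (Fin d))
      (A : EuclideanSpace ℝ (Fin d) →ₗᵢ[ℝ] EuclideanSpace ℝ (Fin d)), q ∈ P.points ∧
      (∀ p ∈ P.points, dist p q ≤ (k : ℝ) + 1 →
        ∃ j : Fin N, dist (x N j) (x N i + A (p - q)) ≤ 1 / ((k : ℝ) + 1)) ∧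
      (∀ j : Fin N, dist (x N j) (x N i) ≤ (k : ℝ) + 1 →
        ∃ p ∈ P.points, dist (x N j) (x N i + A (p - q)) ≤ 1 / ((k : ℝ) + 1)) := by
    intro k
    have ht := hDV ((k : ℝ) + 1) (1 / ((k : ℝ) + 1)) (by positivity) (by positivity) x hx
    filter_upwards [ht.eventually (gt_mem_nhds (show (0 : ℝ) < 1 / 2 by norm_num)),
      eventually_ge_atTop 1] with N hN hN1
    obtain ⟨i, q, hq, A, hA⟩ := exists_good_of_card_div_lt hN1 hN
    exact ⟨i, q, A, hq, hA⟩
  -- Step 2: extract `N_k = φ k ↑`, good particles `i k`, base points `q k`, charts `A k`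
  obtain ⟨φ, hφ, hgood⟩ := extraction_forall_of_eventually hev
  choose i q A hq hA using hgood
  -- Step 3: pigeonhole on the motif class of `q k`
  have hrep : ∀ k, ∃ z ∈ P.motif, q k - z ∈ P.lattice := fun k => P.exists_sub_mem_lattice (hq k)
  choose z hz hzq using hrep
  obtain ⟨z₀, hinf⟩ := Finite.exists_infinite_fiber (fun k => (⟨z k, hz k⟩ : P.motif))
  have hfreq : ∃ᶠ k in atTop, (⟨z k, hz k⟩ : P.motif) = z₀ := by
    rw [Nat.frequently_atTop_iff_infinite]
    exact Set.infinite_coe_iff.1 hinf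
  obtain ⟨ψ₁, hψ₁, hz₀⟩ := extraction_of_frequently_atTop hfreq
  have hz₀' : ∀ l, z (ψ₁ l) = z₀.1 := fun l => congrArg Subtype.val (hz₀ l)
  have hqz : ∀ l, q (ψ₁ l) - z₀.1 ∈ P.lattice := fun l => by rw [← hz₀' l]; exact hzq (ψ₁ l)
  -- the single rooted reference configuration
  set P₀ : PeriodicConfiguration d := P.translate (-z₀.1) with hP₀
  -- Step 4: recentre along `ψ₁`
  set n : ℕ → ℕ := fun l => φ (ψ₁ l) with hn
  set τ : ℕ → EuclideanSpace ℝ (Fin d) := fun l => -x (n l) (i (ψ₁ l)) with hτ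
  set y : (l : ℕ) → Fin (n l) → EuclideanSpace ℝ (Fin d) := fun l j => x (n l) j + τ l with hy
  set A' : ℕ → EuclideanSpace ℝ (Fin d) →ₗᵢ[ℝ] EuclideanSpace ℝ (Fin d) := fun l => A (ψ₁ l)
    with hA'
  have hdist : ∀ l j w, dist (y l j) w = dist (x (n l) j) (x (n l) (i (ψ₁ l)) + w) := by
    intro l j w
    show dist (x (n l) j + -x (n l) (i (ψ₁ l))) w = _
    rw [← dist_add_right (x (n l) j + -x (n l) (i (ψ₁ l))) w (x (n l) (i (ψ₁ l))),
      neg_add_cancel_right, add_comm w]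
  have hnorm : ∀ l j, ‖y l j‖ = dist (x (n l) j) (x (n l) (i (ψ₁ l))) := fun l j => by
    show ‖x (n l) j + -x (n l) (i (ψ₁ l))‖ = _
    rw [← sub_eq_add_neg, dist_eq_norm]
  have hscale : ∀ l : ℕ, (l : ℝ) + 1 ≤ (ψ₁ l : ℝ) + 1 ∧ 1 / ((ψ₁ l : ℝ) + 1) ≤ 1 / ((l : ℝ) + 1) := by
    intro l
    have h1 : (l : ℝ) ≤ (ψ₁ l : ℝ) := by exact_mod_cast hψ₁.le_apply
    exact ⟨by linarith, by gcongr⟩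
  have hy' : ∀ l : ℕ,
      (∀ p ∈ P₀.points, ‖p‖ ≤ (l : ℝ) + 1 → ∃ j, dist (y l j) (A' l p) ≤ 1 / ((l : ℝ) + 1)) ∧
      (∀ j, ‖y l j‖ ≤ (l : ℝ) + 1 → ∃ p ∈ P₀.points, dist (y l j) (A' l p) ≤ 1 / ((l : ℝ) + 1)) := by
    intro l
    obtain ⟨h1, h2⟩ := hA (ψ₁ l)
    obtain ⟨hl1, hl2⟩ := hscale l
    refine ⟨fun p hp hpl => ?_, fun j hj => ?_⟩
    · have hpq : p + q (ψ₁ l) ∈ P.points := (mem_points_translate_neg_iff P (hqz l) p).1 hp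
      have hd : dist (p + q (ψ₁ l)) (q (ψ₁ l)) ≤ (ψ₁ l : ℝ) + 1 := by
        rw [dist_eq_norm, add_sub_cancel_right]; exact hpl.trans hl1
      obtain ⟨j, hj⟩ := h1 (p + q (ψ₁ l)) hpq hd
      rw [add_sub_cancel_right] at hj
      exact ⟨j, by rw [hdist]; exact hj.trans hl2⟩
    · obtain ⟨p, hp, hjp⟩ := h2 j (by rw [← hnorm]; exact hj.trans hl1)
      refine ⟨p - q (ψ₁ l), (mem_points_translate_neg_iff P (hqz l) _).2 (by
        rw [sub_add_cancel]; exact hp), ?_⟩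
      rw [hdist]
      exact hjp.trans hl2
  -- Step 5: converging charts, one rotated limit configuration
  obtain ⟨ψ, B, hψ, hmatch⟩ := eventually_matched_isometryImage P₀ y A' hy'
  -- Step 6: minimal distance + approximate matching ⇒ local convergence
  have hsep' : ∀ l (j j' : Fin (n (ψ l))), j ≠ j' → δ ≤ dist (y (ψ l) j) (y (ψ l) j') := by
    intro l j j' hjj'
    show δ ≤ dist (x (n (ψ l)) j + τ (ψ l)) (x (n (ψ l)) j' + τ (ψ l))
    rw [dist_add_right]
    exact hsep _ _ (hx _) j j' hjj'
  have hnmono : StrictMono n := hφ.comp hψ₁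
  refine ⟨n ∘ ψ, τ ∘ ψ, P₀.isometryImage B, fun _ => 1, hnmono.comp hψ, fun _ _ => le_rfl,
    fun _ _ _ => rfl, fun f hfc hf => ?_⟩
  exact (P₀.isometryImage B).tendsto_sum_of_eventually_near' (fun l => y (ψ l)) hδ hsep' hmatch hfc hf

/-- **Item stmt-AtomisticToContinuum-12567** (`DefectVanishCrystallizes`, route
FreeSplittingCertificates): for every periodic `P`, `DefectVanish(P) → IsCrystallizing lennardJones 3`
— by `isCrystallizing_of_defectVanish` at `V = V_LJ`, `d = 3`, with the uniform minimal distance of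
Lennard-Jones ground states `LennardJonesMinimalDistance_holds` (proved in the tree). [folklore] -/
theorem defectVanishCrystallizes_proof :
    Summit.AtomisticToContinuum.Crystallization.Theses.FreeSplittingCertificates.DefectVanishCrystallizes := by
  unfold Summit.AtomisticToContinuum.Crystallization.Theses.FreeSplittingCertificates.DefectVanishCrystallizes
  intro P hP
  obtain ⟨δ, hδ, hsep⟩ := LennardJonesMinimalDistance_holds
  exact isCrystallizing_of_defectVanish P hP hδ hsep

end Summit.AtomisticToContinuum.Crystallization.Theorems.FreeSplittingCertificatesDefectVanishCrystallizes

end
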